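import Literature.Computability.Complexity.CodeFPRegs
import HarnessLib

/-!
# The unit-residue algorithm as a register program

Topic `Computability/Cryptography`, the machine layer under `UnitResidueAlgorithm.lean` /
`UnitResidueMain.lean` (the abstract algorithm `algo d r m N` computing the fundamental unit of
`ℚ(√d)` modulo `m` from an integer `r` near its regulator, after Jacobson–Williams, *Solving the Pell
Equation*, Ch. 12 and §5, §7.4) and above `Complexity/CodeFPRegs.lean` (register programs with
clamped loops are typed polynomial time). This file contains NO number theory: it writes the
algorithm as ONE register program `prog` over 25 integer registers, together with, for every
straight-line block, the "machine function" on register files (`MS`) it computes and the symbolic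
execution lemma `block.run N S.lay = (blockFn N S).lay` (`simp`), and the generic simulation lemma
for clamped loops (`run_loop_sim`: if a predicate is preserved by the body function and bounds every
register by `2ᴺ`, the loop runs the body function `N` times). The coordinates `p, r` of `θ, θψ`
(which grow exponentially) are kept reduced modulo `m`; everything else is the abstract algorithm
verbatim. The identification with `algo` (invariants, bounds, congruences) is
`UnitResidueSim.lean`.

Register layout: `0 d, 1 r, 2 m` (inputs), `3 a, 4 b, 5 p₁, 6 p₂, 7 r₁, 8 r₂, 9 sgn, 10 M, 11 E`
(the state `AS`), `12 i, 13 acc, 14 r₂, 15 k₀, 16 g, 17 ν, 18 λ`, `19 u, 20 v, 21 w, 22 t`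
(temporaries / the extended-Euclid state), `23 ox, 24 oy` (outputs / scratch).

## References

* M. J. Jacobson Jr., H. C. Williams, *Solving the Pell Equation*, CMS Books in Mathematics,
  Springer 2009, Ch. 12 (Alg. 12.6), §5.3–5.4, §7.4. [JacobsonWilliams2008]
* S. Arora, B. Barak, *Computational Complexity: A Modern Approach*, CUP 2009, §1.3. [AroraBarak2009]
-/

namespace Literature.Computability.Cryptography.UnitResidue

open Literature.Computability.Complexity Literature.Computability.Complexity.RegProg

/-! ### Register files -/

/-- The 25 registers of the machine. [folklore] -/
structure MS where
  (d r m a b p1 p2 r1 r2 sgn M E i acc rr k0 g nu lam u v w t ox oy : ℤ)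

/-- The register file of a machine state. [folklore] -/
def MS.lay (S : MS) : List ℤ :=
  [S.d, S.r, S.m, S.a, S.b, S.p1, S.p2, S.r1, S.r2, S.sgn, S.M, S.E, S.i, S.acc, S.rr, S.k0, S.g,
    S.nu, S.lam, S.u, S.v, S.w, S.t, S.ox, S.oy]

/-- The register file has length `25`. [folklore] -/
@[simp] theorem MS.length_lay (S : MS) : S.lay.length = 25 := rfl

/-! ### Evaluation of expressions, in closed form -/

/-- Bit size (of the nonnegative part). [folklore] -/
def szZ (z : ℤ) : ℤ := (Nat.size z.toNat : ℕ)
/-- Integer square root (of the nonnegative part). [folklore] -/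
def sqZ (z : ℤ) : ℤ := (Nat.sqrt z.toNat : ℕ)
/-- `2 ^ min(z⁺, N)`. [folklore] -/
def p2Z (N : ℕ) (z : ℤ) : ℤ := ((2 : ℕ) ^ min z.toNat N : ℕ)

/-- Truncated subtraction as an expression. [folklore] -/
def monus (a b : Ex) : Ex := .ite (.le b a) (.sub a b) (.cst 0)

section Eval

variable (N : ℕ) (l : List ℤ)

/-- Closed form of the value of the expression `reg` on a register file. [folklore] -/
@[simp] theorem eval_reg (i : ℕ) : (Ex.reg i).eval N l = l.getD i 0 := rfl
/-- Closed form of the value of the expression `cst` on a register file. [folklore] -/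
@[simp] theorem eval_cst (z : ℤ) : (Ex.cst z).eval N l = z := rfl
/-- Closed form of the value of the expression `add` on a register file. [folklore] -/
@[simp] theorem eval_add (a b : Ex) : (Ex.add a b).eval N l = a.eval N l + b.eval N l := rfl
/-- Closed form of the value of the expression `sub` on a register file. [folklore] -/
@[simp] theorem eval_sub (a b : Ex) : (Ex.sub a b).eval N l = a.eval N l - b.eval N l := rfl
/-- Closed form of the value of the expression `mul` on a register file. [folklore] -/
@[simp] theorem eval_mul (a b : Ex) : (Ex.mul a b).eval N l = a.eval N l * b.eval N l := rfl
/-- Closed form of the value of the expression `ediv` on a register file. [folklore] -/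
@[simp] theorem eval_ediv (a b : Ex) : (Ex.ediv a b).eval N l = a.eval N l / b.eval N l := rfl
/-- Closed form of the value of the expression `abs` on a register file. [folklore] -/
@[simp] theorem eval_abs (a : Ex) : (Ex.abs a).eval N l = |a.eval N l| := rfl
/-- Closed form of the value of the expression `sqrt` on a register file. [folklore] -/
@[simp] theorem eval_sqrt (a : Ex) : (Ex.sqrt a).eval N l = sqZ (a.eval N l) := rfl
/-- Closed form of the value of the expression `size` on a register file. [folklore] -/
@[simp] theorem eval_size (a : Ex) : (Ex.size a).eval N l = szZ (a.eval N l) := rfl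
/-- Closed form of the value of the expression `pow2` on a register file. [folklore] -/
@[simp] theorem eval_pow2 (a : Ex) : (Ex.pow2 a).eval N l = p2Z N (a.eval N l) := rfl
/-- Closed form of the value of the expression `lt` on a register file. [folklore] -/
@[simp] theorem eval_lt (a b : Ex) : (Ex.lt a b).eval N l = if a.eval N l < b.eval N l then 1 else 0 := rfl
/-- Closed form of the value of the expression `le` on a register file. [folklore] -/
@[simp] theorem eval_le (a b : Ex) : (Ex.le a b).eval N l = if a.eval N l ≤ b.eval N l then 1 else 0 := rfl
/-- Closed form of the value of the expression `eq` on a register file. [folklore] -/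
@[simp] theorem eval_eq (a b : Ex) : (Ex.eq a b).eval N l = if a.eval N l = b.eval N l then 1 else 0 := rfl
/-- Closed form of the value of the expression `ite` on a register file. [folklore] -/
theorem eval_ite (c a b : Ex) :
    (Ex.ite c a b).eval N l = if c.eval N l = 0 then b.eval N l else a.eval N l := rfl
/-- Closed form of the value of the expression `ite_lt` on a register file. [folklore] -/
@[simp] theorem eval_ite_lt (c1 c2 a b : Ex) : (Ex.ite (.lt c1 c2) a b).eval N l =
    if c1.eval N l < c2.eval N l then a.eval N l else b.eval N l := by
  rw [eval_ite, eval_lt]; split_ifs <;> first | rfl | simp_all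
/-- Closed form of the value of the expression `ite_le` on a register file. [folklore] -/
@[simp] theorem eval_ite_le (c1 c2 a b : Ex) : (Ex.ite (.le c1 c2) a b).eval N l =
    if c1.eval N l ≤ c2.eval N l then a.eval N l else b.eval N l := by
  rw [eval_ite, eval_le]; split_ifs <;> first | rfl | simp_all
/-- Closed form of the value of the expression `ite_eq` on a register file. [folklore] -/
@[simp] theorem eval_ite_eq (c1 c2 a b : Ex) : (Ex.ite (.eq c1 c2) a b).eval N l =
    if c1.eval N l = c2.eval N l then a.eval N l else b.eval N l := by
  rw [eval_ite, eval_eq]; split_ifs <;> first | rfl | simp_all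
/-- Closed form of the value of the expression `ite_and` on a register file. [folklore] -/
@[simp] theorem eval_ite_and (c1 c2 c3 c4 a b : Ex) : (Ex.ite (.mul (.lt c1 c2) (.lt c3 c4)) a b).eval N l =
    if c1.eval N l < c2.eval N l ∧ c3.eval N l < c4.eval N l then a.eval N l else b.eval N l := by
  rw [eval_ite, eval_mul, eval_lt, eval_lt]; split_ifs <;> simp_all

/-- Closed form of the value of the expression `monus` on a register file. [folklore] -/
@[simp] theorem eval_monus (a b : Ex) : (monus a b).eval N l = ((a.eval N l - b.eval N l).toNat : ℕ) := by
  simp only [monus, eval_ite_le, eval_sub, eval_cst]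
  by_cases h : b.eval N l ≤ a.eval N l
  · rw [if_pos h, Int.toNat_of_nonneg (by omega)]
  · rw [if_neg h, Int.toNat_eq_zero.mpr (by omega)]; rfl

end Eval

/-! ### Static data as expressions of the inputs -/

/-- `n = |d| + |r| + |m| + 4`. [folklore] -/
def nE : Ex := .add (.add (.add (.size (.reg 0)) (.size (.reg 1))) (.size (.reg 2))) (.cst 4)
/-- `Δ = disc d`. [folklore] -/
def ΔE : Ex := .ite (.eq (Ex.emod (.reg 0) (.cst 4)) (.cst 1)) (.reg 0) (.mul (.cst 4) (.reg 0))
/-- `P = 3n + 16`. [folklore] -/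
def PE : Ex := .add (.mul (.cst 3) nE) (.cst 16)
/-- `q = 4n + 22`. [folklore] -/
def qE : Ex := .add (.mul (.cst 4) nE) (.cst 22)
/-- `K = 2n + 12`. [folklore] -/
def KE : Ex := .add (.mul (.cst 2) nE) (.cst 12)
/-- `c₀ = 2n + 8`. [folklore] -/
def c0E : Ex := .add (.mul (.cst 2) nE) (.cst 8)
/-- `Sq = ⌊2^q √Δ⌋`. [folklore] -/
def SqE : Ex := .sqrt (.mul ΔE (.pow2 (.mul (.cst 2) qE)))
/-- `S = ⌊√Δ⌋`. [folklore] -/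
def SE : Ex := .sqrt ΔE
/-- `σ = Δ mod 2`. [folklore] -/
def sigE : Ex := Ex.emod ΔE (.cst 2)
/-- `(Δ - σ)/4`. [folklore] -/
def cwE : Ex := .ediv (.sub ΔE sigE) (.cst 4)
/-- `1` or `2` according as `d ≡ 1 (4)` or not. [folklore] -/
def dKE : Ex := .ite (.eq (Ex.emod (.reg 0) (.cst 4)) (.cst 1)) (.cst 1) (.cst 2)
/-- `T = r₂ - 4n`. [folklore] -/
def TE : Ex := .sub (.reg 14) (.mul (.cst 4) nE)
/-- `l = |T| - 1`. [folklore] -/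
def lE : Ex := .sub (.size TE) (.cst 1)
/-- `pref k = T / 2^(l - k)`. [folklore] -/
def prefE (k : Ex) : Ex := .ediv TE (.pow2 (.sub lE k))
/-- the target of the guarded walk at level `k₀ + i`: `pref (k₀ + i) - c₀`. [folklore] -/
def tgtE : Ex := .sub (prefE (.add (.reg 15) (.reg 12))) c0E

/-- Closed form `nZ` (on integers) of the corresponding expression. [folklore] -/
def nZ (d r m : ℤ) : ℤ := szZ d + szZ r + szZ m + 4
/-- Closed form `discZ` (on integers) of the corresponding expression. [folklore] -/
def discZ (d : ℤ) : ℤ := if d % 4 = 1 then d else 4 * d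
/-- Closed form `PZ` (on integers) of the corresponding expression. [folklore] -/
def PZ (d r m : ℤ) : ℤ := 3 * nZ d r m + 16
/-- Closed form `qZ` (on integers) of the corresponding expression. [folklore] -/
def qZ (d r m : ℤ) : ℤ := 4 * nZ d r m + 22
/-- Closed form `KZ` (on integers) of the corresponding expression. [folklore] -/
def KZ (d r m : ℤ) : ℤ := 2 * nZ d r m + 12
/-- Closed form `c0Z` (on integers) of the corresponding expression. [folklore] -/
def c0Z (d r m : ℤ) : ℤ := 2 * nZ d r m + 8
/-- Closed form `SqZ` (on integers) of the corresponding expression. [folklore] -/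
def SqZ (N : ℕ) (d r m : ℤ) : ℤ := sqZ (discZ d * p2Z N (2 * qZ d r m))
/-- Closed form `SZ` (on integers) of the corresponding expression. [folklore] -/
def SZ (d : ℤ) : ℤ := sqZ (discZ d)
/-- Closed form `sigZ` (on integers) of the corresponding expression. [folklore] -/
def sigZ (d : ℤ) : ℤ := discZ d % 2
/-- Closed form `cwZ` (on integers) of the corresponding expression. [folklore] -/
def cwZ (d : ℤ) : ℤ := (discZ d - sigZ d) / 4
/-- Closed form `dKZ` (on integers) of the corresponding expression. [folklore] -/
def dKZ (d : ℤ) : ℤ := if d % 4 = 1 then 1 else 2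
/-- Closed form `TZ` (on integers) of the corresponding expression. [folklore] -/
def TZ (d r m rr : ℤ) : ℤ := rr - 4 * nZ d r m
/-- Closed form `lZ` (on integers) of the corresponding expression. [folklore] -/
def lZ (d r m rr : ℤ) : ℤ := szZ (TZ d r m rr) - 1
/-- Closed form `prefZ` (on integers) of the corresponding expression. [folklore] -/
def prefZ (N : ℕ) (d r m rr k : ℤ) : ℤ := TZ d r m rr / p2Z N (lZ d r m rr - k)

section Static

variable (N : ℕ) (d r m a b p1 p2 r1 r2 sgn M E i acc rr k0 : ℤ) (rest : List ℤ)

/-- Closed form of the value of the expression `nE` on a register file. [folklore] -/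
@[simp] theorem eval_nE : nE.eval N (d :: r :: m :: rest) = nZ d r m := by simp [nE, nZ]
/-- Closed form of the value of the expression `ΔE` on a register file. [folklore] -/
@[simp] theorem eval_ΔE : ΔE.eval N (d :: r :: m :: rest) = discZ d := by simp [ΔE, discZ]
/-- Closed form of the value of the expression `PE` on a register file. [folklore] -/
@[simp] theorem eval_PE : PE.eval N (d :: r :: m :: rest) = PZ d r m := by simp [PE, PZ]
/-- Closed form of the value of the expression `qE` on a register file. [folklore] -/
@[simp] theorem eval_qE : qE.eval N (d :: r :: m :: rest) = qZ d r m := by simp [qE, qZ]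
/-- Closed form of the value of the expression `KE` on a register file. [folklore] -/
@[simp] theorem eval_KE : KE.eval N (d :: r :: m :: rest) = KZ d r m := by simp [KE, KZ]
/-- Closed form of the value of the expression `c0E` on a register file. [folklore] -/
@[simp] theorem eval_c0E : c0E.eval N (d :: r :: m :: rest) = c0Z d r m := by simp [c0E, c0Z]
/-- Closed form of the value of the expression `SqE` on a register file. [folklore] -/
@[simp] theorem eval_SqE : SqE.eval N (d :: r :: m :: rest) = SqZ N d r m := by simp [SqE, SqZ]
/-- Closed form of the value of the expression `SE` on a register file. [folklore] -/
@[simp] theorem eval_SE : SE.eval N (d :: r :: m :: rest) = SZ d := by simp [SE, SZ]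
/-- Closed form of the value of the expression `sigE` on a register file. [folklore] -/
@[simp] theorem eval_sigE : sigE.eval N (d :: r :: m :: rest) = sigZ d := by simp [sigE, sigZ]
/-- Closed form of the value of the expression `cwE` on a register file. [folklore] -/
@[simp] theorem eval_cwE : cwE.eval N (d :: r :: m :: rest) = cwZ d := by simp [cwE, cwZ]
/-- Closed form of the value of the expression `dKE` on a register file. [folklore] -/
@[simp] theorem eval_dKE : dKE.eval N (d :: r :: m :: rest) = dKZ d := by simp [dKE, dKZ]
/-- Closed form of the value of the expression `TE` on a register file. [folklore] -/
@[simp] theorem eval_TE :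
    TE.eval N (d :: r :: m :: a :: b :: p1 :: p2 :: r1 :: r2 :: sgn :: M :: E :: i :: acc :: rr :: rest) =
      TZ d r m rr := by simp [TE, TZ]
/-- Closed form of the value of the expression `lE` on a register file. [folklore] -/
@[simp] theorem eval_lE :
    lE.eval N (d :: r :: m :: a :: b :: p1 :: p2 :: r1 :: r2 :: sgn :: M :: E :: i :: acc :: rr :: rest) =
      lZ d r m rr := by simp [lE, lZ]
/-- Closed form of the value of the expression `prefE` on a register file. [folklore] -/
@[simp] theorem eval_prefE (k : Ex) :
    (prefE k).eval N (d :: r :: m :: a :: b :: p1 :: p2 :: r1 :: r2 :: sgn :: M :: E :: i :: acc :: rr :: rest) =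
      prefZ N d r m rr
        (k.eval N (d :: r :: m :: a :: b :: p1 :: p2 :: r1 :: r2 :: sgn :: M :: E :: i :: acc :: rr :: rest)) := by
  simp [prefE, prefZ]
/-- Closed form of the value of the expression `tgtE` on a register file. [folklore] -/
@[simp] theorem eval_tgtE :
    tgtE.eval N (d :: r :: m :: a :: b :: p1 :: p2 :: r1 :: r2 :: sgn :: M :: E :: i :: acc :: rr :: k0 :: rest) =
      prefZ N d r m rr (k0 + i) - c0Z d r m := by
  simp [tgtE]

end Static

/-! ### Shared arithmetic: `c`, the factor float, products of floats -/

/-- `c = (Δ - b²)/4a`. [folklore] -/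
def cE : Ex := .ediv (.sub ΔE (.mul (.reg 4) (.reg 4))) (.mul (.cst 4) (.reg 3))
/-- Closed form `cZ` (on integers) of the corresponding expression. [folklore] -/
def cZ (d a b : ℤ) : ℤ := (discZ d - b * b) / (4 * a)

/-- Closed form of the value of the expression `cE` on a register file. [folklore] -/
@[simp] theorem eval_cE (N : ℕ) (d r m a b : ℤ) (rest : List ℤ) :
    cE.eval N (d :: r :: m :: a :: b :: rest) = cZ d a b := by simp [cE, cZ]

/-- The float of `u/v` (`UnitResidueFloat.floatOf`), exponents capped at `N`. [folklore] -/
def floatTz (P u v : ℤ) : ℤ := ((P + 3 + szZ v - szZ u).toNat : ℕ)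
/-- The wide mantissa `⌊u 2^t / v⌋` of `floatOfz` (capped exponent). [folklore] -/
def floatM1z (N : ℕ) (P u v : ℤ) : ℤ := u * p2Z N (floatTz P u v) / v
/-- The final shift of `floatOfz`. [folklore] -/
def floatShz (N : ℕ) (P u v : ℤ) : ℤ := ((szZ (floatM1z N P u v) - (P + 1)).toNat : ℕ)
/-- The float `(M, E)` of `u/v` with exponents capped at `N` (`UnitResidueFloat.floatOf`). [folklore] -/
def floatOfz (N : ℕ) (P u v : ℤ) : ℤ × ℤ :=
  (floatM1z N P u v / p2Z N (floatShz N P u v), floatShz N P u v - floatTz P u v)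

/-- The expression `floatTE` of the register program. [folklore] -/
def floatTE (pe u v : Ex) : Ex := monus (.add (.add pe (.cst 3)) (.size v)) (.size u)
/-- The expression `floatM1E` of the register program. [folklore] -/
def floatM1E (pe u v : Ex) : Ex := .ediv (.mul u (.pow2 (floatTE pe u v))) v
/-- The expression `floatShE` of the register program. [folklore] -/
def floatShE (pe u v : Ex) : Ex := monus (.size (floatM1E pe u v)) (.add pe (.cst 1))
/-- The mantissa of the float of `u/v`, as an expression. [folklore] -/
def floatOfE1 (pe u v : Ex) : Ex := .ediv (floatM1E pe u v) (.pow2 (floatShE pe u v))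
/-- The exponent of the float of `u/v`, as an expression. [folklore] -/
def floatOfE2 (pe u v : Ex) : Ex := .sub (floatShE pe u v) (floatTE pe u v)

/-- Closed form of the value of the expression `floatOfE1` on a register file. [folklore] -/
@[simp] theorem eval_floatOfE1 (N : ℕ) (l : List ℤ) (pe u v : Ex) :
    (floatOfE1 pe u v).eval N l = (floatOfz N (pe.eval N l) (u.eval N l) (v.eval N l)).1 := by
  simp [floatOfE1, floatOfz, floatM1E, floatM1z, floatShE, floatShz, floatTE, floatTz]
/-- Closed form of the value of the expression `floatOfE2` on a register file. [folklore] -/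
@[simp] theorem eval_floatOfE2 (N : ℕ) (l : List ℤ) (pe u v : Ex) :
    (floatOfE2 pe u v).eval N l = (floatOfz N (pe.eval N l) (u.eval N l) (v.eval N l)).2 := by
  simp [floatOfE2, floatOfz, floatM1E, floatM1z, floatShE, floatShz, floatTE, floatTz]

/-- Products of floats (`UnitResidueFloat.mulF`), exponents capped at `N`: mantissa and exponent. [folklore] -/
def mulMz (N : ℕ) (P M₁ M₂ : ℤ) : ℤ :=
  if M₁ * M₂ < p2Z N (2 * P + 1) then M₁ * M₂ / p2Z N P else M₁ * M₂ / p2Z N (P + 1)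
/-- The exponent of a product of floats (capped). [folklore] -/
def mulEz (N : ℕ) (P M₁ E₁ M₂ E₂ : ℤ) : ℤ :=
  if M₁ * M₂ < p2Z N (2 * P + 1) then E₁ + E₂ + P else E₁ + E₂ + P + 1
/-- The product of floats `(M, E)` with exponents capped at `N` (`UnitResidueFloat.mulF`). [folklore] -/
def mulFz (N : ℕ) (P M₁ E₁ M₂ E₂ : ℤ) : ℤ × ℤ := (mulMz N P M₁ M₂, mulEz N P M₁ E₁ M₂ E₂)

/-- The mantissa of a product of floats, as an expression. [folklore] -/
def mulFE1 (pe m1 m2 : Ex) : Ex :=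
  .ite (.lt (.mul m1 m2) (.pow2 (.add (.mul (.cst 2) pe) (.cst 1)))) (.ediv (.mul m1 m2) (.pow2 pe))
    (.ediv (.mul m1 m2) (.pow2 (.add pe (.cst 1))))
/-- The exponent of a product of floats, as an expression. [folklore] -/
def mulFE2 (pe m1 e1 m2 e2 : Ex) : Ex :=
  .ite (.lt (.mul m1 m2) (.pow2 (.add (.mul (.cst 2) pe) (.cst 1)))) (.add (.add e1 e2) pe)
    (.add (.add (.add e1 e2) pe) (.cst 1))

/-- Closed form of the value of the expression `mulFE1` on a register file. [folklore] -/
@[simp] theorem eval_mulFE1 (N : ℕ) (l : List ℤ) (pe m1 m2 : Ex) :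
    (mulFE1 pe m1 m2).eval N l = mulMz N (pe.eval N l) (m1.eval N l) (m2.eval N l) := by
  simp only [mulFE1, mulMz, eval_ite_lt, eval_mul, eval_pow2, eval_add, eval_cst, eval_ediv]
/-- Closed form of the value of the expression `mulFE2` on a register file. [folklore] -/
@[simp] theorem eval_mulFE2 (N : ℕ) (l : List ℤ) (pe m1 e1 m2 e2 : Ex) :
    (mulFE2 pe m1 e1 m2 e2).eval N l =
      mulEz N (pe.eval N l) (m1.eval N l) (e1.eval N l) (m2.eval N l) (e2.eval N l) := by
  simp only [mulFE2, mulEz, eval_ite_lt, eval_mul, eval_pow2, eval_add, eval_cst]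

/-- The factor `ψ = |b 2^q + Sq| / (a 2^{q+1})` as a float (`UnitResidueSteps.facF`). [folklore] -/
def facUE : Ex := .abs (.add (.mul (.reg 4) (.pow2 qE)) SqE)
/-- The expression `facVE` of the register program. [folklore] -/
def facVE : Ex := .mul (.reg 3) (.pow2 (.add qE (.cst 1)))
/-- The numerator `|b 2^q + Sq|` of the factor, on integers. [folklore] -/
def facUz (N : ℕ) (d r m b : ℤ) : ℤ := |b * p2Z N (qZ d r m) + SqZ N d r m|
/-- The denominator `a 2^{q+1}` of the factor, on integers. [folklore] -/
def facVz (N : ℕ) (d r m a : ℤ) : ℤ := a * p2Z N (qZ d r m + 1)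

/-- Closed form of the value of the expression `facUE` on a register file. [folklore] -/
@[simp] theorem eval_facUE (N : ℕ) (d r m a b : ℤ) (rest : List ℤ) :
    facUE.eval N (d :: r :: m :: a :: b :: rest) = facUz N d r m b := by simp [facUE, facUz]
/-- Closed form of the value of the expression `facVE` on a register file. [folklore] -/
@[simp] theorem eval_facVE (N : ℕ) (d r m a b : ℤ) (rest : List ℤ) :
    facVE.eval N (d :: r :: m :: a :: b :: rest) = facVz N d r m a := by simp [facVE, facVz]

/-- The float of the factor and the updated distance float of a state. [folklore] -/
def MS.fac (N : ℕ) (S : MS) : ℤ × ℤ := floatOfz N (PZ S.d S.r S.m) (facUz N S.d S.r S.m S.b) (facVz N S.d S.r S.m S.a)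
/-- The updated distance float `(M, E) · fac` of a state. [folklore] -/
def MS.mf (N : ℕ) (S : MS) : ℤ × ℤ := mulFz N (PZ S.d S.r S.m) S.M S.E (S.fac N).1 (S.fac N).2

/-! ### Programs -/

local infixr:65 " ;; " => Prog.seq

/-- Update of the distance float by the factor of the CURRENT frame: `(M, E) := mulF (M, E) (facF a b)`
(scratch `v, w, t`). [folklore] -/
def mulFacBlk : Prog :=
  .set 20 (floatOfE1 PE facUE facVE) ;; .set 21 (floatOfE2 PE facUE facVE) ;;
  .set 22 (mulFE1 PE (.reg 10) (.reg 20)) ;;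
  .set 11 (mulFE2 PE (.reg 10) (.reg 11) (.reg 20) (.reg 21)) ;; .set 10 (.reg 22) ;;
  .set 20 (.cst 0) ;; .set 21 (.cst 0) ;; .set 22 (.cst 0)

/-- Machine function of `mulFacBlk`: `(M, E) := mulF (M, E) (facF a b)`, scratch zeroed. [folklore] -/
def MS.mulFacM (N : ℕ) (S : MS) : MS :=
  { S with E := (S.mf N).2, M := (S.mf N).1, v := 0, w := 0, t := 0 }

/-- The baby step on the frame, `p, r` modulo `m` (scratch `u, v, w`):
`u := b; a := c; b := S - ((S + u) mod 2a); v := (b + u)/2a; p := r mod m; r := (p + v r) mod m`. [folklore] -/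
def bstepBlk : Prog :=
  .set 19 (.reg 4) ;; .set 3 cE ;;
  .set 4 (.sub SE (Ex.emod (.add SE (.reg 19)) (.mul (.cst 2) (.reg 3)))) ;;
  .set 20 (.ediv (.add (.reg 4) (.reg 19)) (.mul (.cst 2) (.reg 3))) ;;
  .set 21 (.reg 5) ;; .set 5 (Ex.emod (.reg 7) (.reg 2)) ;;
  .set 7 (Ex.emod (.add (.mul (.cst 1) (.reg 21)) (.mul (.reg 20) (.reg 7))) (.reg 2)) ;;
  .set 21 (.reg 6) ;; .set 6 (Ex.emod (.reg 8) (.reg 2)) ;;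
  .set 8 (Ex.emod (.add (.mul (.cst 1) (.reg 21)) (.mul (.reg 20) (.reg 8))) (.reg 2)) ;;
  .set 19 (.cst 0) ;; .set 20 (.cst 0) ;; .set 21 (.cst 0)

/-- Machine function of `bstepBlk`: the baby step on the frame with `p, r` modulo `m`, scratch zeroed. [folklore] -/
def MS.bstepM (S : MS) : MS :=
  let c := cZ S.d S.a S.b
  let b' := SZ S.d - (SZ S.d + S.b) % (2 * c)
  let k := (b' + S.b) / (2 * c)
  { S with
    a := c
    b := b'
    p1 := S.r1 % S.m
    r1 := (1 * S.p1 + k * S.r1) % S.m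
    p2 := S.r2 % S.m
    r2 := (1 * S.p2 + k * S.r2) % S.m
    u := 0
    v := 0
    w := 0 }

/-- `ln2K`: `if i < K then (acc += 2^K / ((i+1) 2^(i+1)); i += 1)`. [folklore] -/
def ln2Body : Prog :=
  .ifp (.lt (.reg 12) KE)
    (.set 13 (.add (.reg 13) (.ediv (.pow2 KE) (.mul (.add (.reg 12) (.cst 1)) (.pow2 (.add (.reg 12) (.cst 1)))))) ;;
      .set 12 (.add (.reg 12) (.cst 1)))

/-- Machine function of `ln2Body`: one term of `ln2K`. [folklore] -/
def MS.ln2M (N : ℕ) (S : MS) : MS :=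
  if S.i < KZ S.d S.r S.m then
    { S with acc := S.acc + p2Z N (KZ S.d S.r S.m) / ((S.i + 1) * p2Z N (S.i + 1)), i := S.i + 1 }
  else S

/-- `b₀ = S - ((S - σ) mod 2)`. [folklore] -/
def b0E : Ex := .sub SE (Ex.emod (.sub SE sigE) (.cst 2))
/-- Closed form `b0Z` (on integers) of the corresponding expression. [folklore] -/
def b0Z (d : ℤ) : ℤ := SZ d - (SZ d - sigZ d) % 2

/-- `r₂ := r 2^K / acc` and the initial state `s₀` (frame `(1, b₀, (1,0), ((b₀-σ)/2, 1))` modulo `m`,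
sign `1`, float `(2^P, -P)`). [folklore] -/
def initBlk : Prog :=
  .set 14 (.ediv (.mul (.reg 1) (.pow2 KE)) (.reg 13)) ;;
  .set 3 (.cst 1) ;; .set 4 b0E ;; .set 5 (Ex.emod (.cst 1) (.reg 2)) ;; .set 6 (Ex.emod (.cst 0) (.reg 2)) ;;
  .set 7 (Ex.emod (.ediv (.sub b0E sigE) (.cst 2)) (.reg 2)) ;; .set 8 (Ex.emod (.cst 1) (.reg 2)) ;;
  .set 9 (.cst 1) ;; .set 10 (.pow2 PE) ;; .set 11 (.sub (.cst 0) PE)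

/-- Machine function of `initBlk`: `r₂` and the initial state `s₀`. [folklore] -/
def MS.initM (N : ℕ) (S : MS) : MS :=
  { S with
    rr := S.r * p2Z N (KZ S.d S.r S.m) / S.acc
    a := 1
    b := b0Z S.d
    p1 := 1 % S.m
    p2 := 0 % S.m
    r1 := (b0Z S.d - sigZ S.d) / 2 % S.m
    r2 := 1 % S.m
    sgn := 1
    M := p2Z N (PZ S.d S.r S.m)
    E := 0 - PZ S.d S.r S.m }

/-- `kz`: `k₀ := if pref k₀ < c₀ + 1 ∧ k₀ < l then k₀ + 1 else k₀`. [folklore] -/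
def kzBody : Prog :=
  .set 15 (.ite (.mul (.lt (prefE (.reg 15)) (.add c0E (.cst 1))) (.lt (.reg 15) lE))
    (.add (.reg 15) (.cst 1)) (.reg 15))

/-- Machine function of `kzBody`: one round of `kz`. [folklore] -/
def MS.kzM (N : ℕ) (S : MS) : MS :=
  { S with k0 := if prefZ N S.d S.r S.m S.rr S.k0 < c0Z S.d S.r S.m + 1 ∧ S.k0 < lZ S.d S.r S.m S.rr
      then S.k0 + 1 else S.k0 }

/-- The guarded baby step with floats: `if E + P < tgt then (mulFac; bstep)`. [folklore] -/
def gstepBody : Prog := .ifp (.lt (.add (.reg 11) PE) tgtE) (mulFacBlk ;; bstepBlk)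

/-- Machine function of `gstepBody`: the guarded baby step with floats. [folklore] -/
def MS.gstepM (N : ℕ) (S : MS) : MS :=
  if S.E + PZ S.d S.r S.m < prefZ N S.d S.r S.m S.rr (S.k0 + S.i) - c0Z S.d S.r S.m then (S.mulFacM N).bstepM
  else S

/-- One round of the extended Euclidean algorithm on `(u, v, w, t)` with coefficients modulo `x`
(`UnitResidueGiant.invStep`; scratch `ox, oy`). [folklore] -/
def invBlk (x : Ex) : Prog :=
  .ifp (.reg 20)
    (.set 23 (.reg 19) ;; .set 19 (.reg 20) ;; .set 20 (Ex.emod (.reg 23) (.reg 19)) ;;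
      .set 24 (.reg 21) ;; .set 21 (.reg 22) ;;
      .set 22 (Ex.emod (.sub (.reg 24) (.mul (.ediv (.reg 23) (.reg 19)) (.reg 22))) x)) ;;
  .set 23 (.cst 0) ;; .set 24 (.cst 0)

/-- Machine function of `invBlk x`: one extended-Euclid round modulo `x`, scratch `ox, oy` zeroed. [folklore] -/
def MS.invM (x : ℤ) (S : MS) : MS :=
  if S.v = 0 then { S with ox := 0, oy := 0 }
  else { S with u := S.v, v := S.u % S.v, w := S.t, t := (S.w - S.u / S.v * S.t) % x, ox := 0, oy := 0 }

/-- `a₁ = a/g`, `b₁ = b/g`. [folklore] -/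
def a1E : Ex := .ediv (.reg 3) (.reg 16)
/-- The expression `b1E` of the register program. [folklore] -/
def b1E : Ex := .ediv (.reg 4) (.reg 16)

/-- Loading the Euclid state: `(u, v, w, t) := (x, y, 0, 1 mod x)`. [folklore] -/
def loadBlk (x y : Ex) : Prog := .set 19 x ;; .set 20 y ;; .set 21 (.cst 0) ;; .set 22 (Ex.emod (.cst 1) x)

/-- The squaring step, part 1: `g := gcd(a, b)` is `u` after the Euclid loop on `(a, b)`; then load
`(a₁, b₁)`. [folklore] -/
def sqMid1 : Prog := .set 16 (.reg 19) ;; loadBlk a1E b1E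
/-- part 2: `ν := w`; load `(g, c)`. [folklore] -/
def sqMid2 : Prog := .set 17 (.reg 21) ;; loadBlk (.reg 16) cE

/-- Coordinates of `omul`: `(x₁y₁ + cw x₂y₂, x₁y₂ + x₂y₁ + σ x₂y₂)`. [folklore] -/
def om1 (x1 x2 y1 y2 : Ex) : Ex := .add (.mul x1 y1) (.mul (.mul cwE x2) y2)
/-- Second coordinate of `omul`, as an expression. [folklore] -/
def om2 (x1 x2 y1 y2 : Ex) : Ex := .add (.add (.mul x1 y2) (.mul x2 y1)) (.mul (.mul sigE x2) y2)

/-- `μ = (1 - ν b₁)/a₁`, `κ = (1 - λ c)/g`. [folklore] -/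
def muE : Ex := .ediv (.sub (.cst 1) (.mul (.reg 17) b1E)) a1E
/-- The expression `kaE` of the register program. [folklore] -/
def kaE : Ex := .ediv (.sub (.cst 1) (.mul (.reg 18) cE)) (.reg 16)

/-- part 3: `λ := w`; the new frame of the squaring (`InfrastructureSquaring.sq`) with `p, r` modulo
`m`, the sign `1`, and the float `(M,E)² · (1/g)`. [folklore] -/
def sqPost : Prog :=
  .set 18 (.reg 21) ;;
  -- p' = inner + (a₁λ) RR,  inner = κ PP - (b₁λ) PR ;  r' = μ PR + ν RR   (all mod m)
  .set 19 (Ex.emod (.add (.mul (.cst 1) (.add (.mul kaE (om1 (.reg 5) (.reg 6) (.reg 5) (.reg 6)))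
      (.mul (.sub (.cst 0) (.mul b1E (.reg 18))) (om1 (.reg 5) (.reg 6) (.reg 7) (.reg 8)))))
      (.mul (.mul a1E (.reg 18)) (om1 (.reg 7) (.reg 8) (.reg 7) (.reg 8)))) (.reg 2)) ;;
  .set 20 (Ex.emod (.add (.mul (.cst 1) (.add (.mul kaE (om2 (.reg 5) (.reg 6) (.reg 5) (.reg 6)))
      (.mul (.sub (.cst 0) (.mul b1E (.reg 18))) (om2 (.reg 5) (.reg 6) (.reg 7) (.reg 8)))))
      (.mul (.mul a1E (.reg 18)) (om2 (.reg 7) (.reg 8) (.reg 7) (.reg 8)))) (.reg 2)) ;;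
  .set 21 (Ex.emod (.add (.mul muE (om1 (.reg 5) (.reg 6) (.reg 7) (.reg 8)))
      (.mul (.reg 17) (om1 (.reg 7) (.reg 8) (.reg 7) (.reg 8)))) (.reg 2)) ;;
  .set 22 (Ex.emod (.add (.mul muE (om2 (.reg 5) (.reg 6) (.reg 7) (.reg 8)))
      (.mul (.reg 17) (om2 (.reg 7) (.reg 8) (.reg 7) (.reg 8)))) (.reg 2)) ;;
  .set 5 (.reg 19) ;; .set 6 (.reg 20) ;; .set 7 (.reg 21) ;; .set 8 (.reg 22) ;;
  .set 4 (.add (.reg 4) (.mul (.mul (.mul (.cst 2) (.reg 17)) a1E) cE)) ;;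
  .set 3 (.mul a1E a1E) ;;
  .set 19 (mulFE1 PE (.reg 10) (.reg 10)) ;; .set 20 (mulFE2 PE (.reg 10) (.reg 11) (.reg 10) (.reg 11)) ;;
  .set 21 (floatOfE1 PE (.cst 1) (.reg 16)) ;; .set 22 (floatOfE2 PE (.cst 1) (.reg 16)) ;;
  .set 10 (mulFE1 PE (.reg 19) (.reg 21)) ;; .set 11 (mulFE2 PE (.reg 19) (.reg 20) (.reg 21) (.reg 22)) ;;
  .set 9 (.cst 1) ;;
  .set 19 (.cst 0) ;; .set 20 (.cst 0) ;; .set 21 (.cst 0) ;; .set 22 (.cst 0) ;;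
  .set 16 (.cst 0) ;; .set 17 (.cst 0) ;; .set 18 (.cst 0)

/-- `omul` on integers. [folklore] -/
def omZ (d : ℤ) (x y : ℤ × ℤ) : ℤ × ℤ :=
  (x.1 * y.1 + cwZ d * x.2 * y.2, x.1 * y.2 + x.2 * y.1 + sigZ d * x.2 * y.2)

/-- Machine function of `sqPost`: the squared frame (`p, r` modulo `m`), sign `1`, float `(M,E)²/g`, scratch and `g, ν, λ` zeroed. [folklore] -/
def MS.sqPostM (N : ℕ) (S : MS) : MS :=
  let lam := S.w
  let a1 := S.a / S.g
  let b1 := S.b / S.g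
  let c := cZ S.d S.a S.b
  let mu := (1 - S.nu * b1) / a1
  let ka := (1 - lam * c) / S.g
  let PP := omZ S.d (S.p1, S.p2) (S.p1, S.p2)
  let PR := omZ S.d (S.p1, S.p2) (S.r1, S.r2)
  let RR := omZ S.d (S.r1, S.r2) (S.r1, S.r2)
  let p1' := (1 * (ka * PP.1 + (0 - b1 * lam) * PR.1) + a1 * lam * RR.1) % S.m
  let p2' := (1 * (ka * PP.2 + (0 - b1 * lam) * PR.2) + a1 * lam * RR.2) % S.m
  let r1' := (mu * PR.1 + S.nu * RR.1) % S.m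
  let r2' := (mu * PR.2 + S.nu * RR.2) % S.m
  let P := PZ S.d S.r S.m
  let F1 := mulFz N P S.M S.E S.M S.E
  let fg := floatOfz N P 1 S.g
  let F2 := mulFz N P F1.1 F1.2 fg.1 fg.2
  { S with
    p1 := p1'
    p2 := p2'
    r1 := r1'
    r2 := r2'
    b := S.b + 2 * S.nu * a1 * c
    a := a1 * a1
    M := F2.1
    E := F2.2
    sgn := 1
    u := 0
    v := 0
    w := 0
    t := 0
    g := 0
    nu := 0
    lam := 0 }

/-- Normalisation of `b` (`InfrastructureReduction.normalize`), `r := (kn p + r) mod m` (scratch `u, v`). [folklore] -/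
def bnE : Ex :=
  .ite (.lt SE (.reg 3))
    (.add (.sub (Ex.emod (.sub (.add (.reg 4) (.reg 3)) (.cst 1)) (.mul (.cst 2) (.reg 3))) (.reg 3)) (.cst 1))
    (.sub SE (Ex.emod (.sub SE (.reg 4)) (.mul (.cst 2) (.reg 3))))

/-- Program block `normBlk` of the unit-residue machine. [folklore] -/
def normBlk : Prog :=
  .set 19 bnE ;; .set 20 (.ediv (.sub (.reg 19) (.reg 4)) (.mul (.cst 2) (.reg 3))) ;; .set 4 (.reg 19) ;;
  .set 7 (Ex.emod (.add (.mul (.reg 20) (.reg 5)) (.mul (.cst 1) (.reg 7))) (.reg 2)) ;;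
  .set 8 (Ex.emod (.add (.mul (.reg 20) (.reg 6)) (.mul (.cst 1) (.reg 8))) (.reg 2)) ;;
  .set 19 (.cst 0) ;; .set 20 (.cst 0)

/-- Closed form `bnZ` (on integers) of the corresponding expression. [folklore] -/
def bnZ (d a b : ℤ) : ℤ :=
  if SZ d < a then (b + a - 1) % (2 * a) - a + 1 else SZ d - (SZ d - b) % (2 * a)

/-- Machine function of `normBlk`: normalisation of `b`, scratch zeroed. [folklore] -/
def MS.normM (S : MS) : MS :=
  let bn := bnZ S.d S.a S.b
  let kn := (bn - S.b) / (2 * S.a)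
  { S with b := bn, r1 := (kn * S.p1 + 1 * S.r1) % S.m, r2 := (kn * S.p2 + 1 * S.r2) % S.m, u := 0, v := 0 }

/-- The `ρ`-step (`InfrastructureReduction.pstep`): `t := c; a := |t|; b := -b; (p, r) := (±r, p) mod m`
(scratch `u, t`). [folklore] -/
def pstepBlk : Prog :=
  .set 22 cE ;; .set 3 (.abs (.reg 22)) ;; .set 4 (.sub (.cst 0) (.reg 4)) ;;
  .set 19 (.reg 5) ;; .set 5 (Ex.emod (.ite (.lt (.cst 0) (.reg 22)) (.reg 7) (.sub (.cst 0) (.reg 7))) (.reg 2)) ;;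
  .set 7 (Ex.emod (.reg 19) (.reg 2)) ;;
  .set 19 (.reg 6) ;; .set 6 (Ex.emod (.ite (.lt (.cst 0) (.reg 22)) (.reg 8) (.sub (.cst 0) (.reg 8))) (.reg 2)) ;;
  .set 8 (Ex.emod (.reg 19) (.reg 2)) ;;
  .set 19 (.cst 0) ;; .set 22 (.cst 0)

/-- Machine function of `pstepBlk`: the `ρ`-step, scratch zeroed. [folklore] -/
def MS.pstepM (S : MS) : MS :=
  let c := cZ S.d S.a S.b
  { S with
    a := |c|
    b := 0 - S.b
    p1 := (if 0 < c then S.r1 else 0 - S.r1) % S.m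
    r1 := S.p1 % S.m
    p2 := (if 0 < c then S.r2 else 0 - S.r2) % S.m
    r2 := S.p2 % S.m
    u := 0
    t := 0 }

/-- "not reduced": `S < b ∨ b + 2a < S + 1 ∨ S < 2a - b` as a sum of tests. [folklore] -/
def notRedE : Ex :=
  .add (.add (.lt SE (.reg 4)) (.lt (.add (.reg 4) (.mul (.cst 2) (.reg 3))) (.add SE (.cst 1))))
    (.lt SE (.sub (.mul (.cst 2) (.reg 3)) (.reg 4)))

/-- Closed form `RedTestZ` (on integers) of the corresponding expression. [folklore] -/
def RedTestZ (d a b : ℤ) : Prop := b ≤ SZ d ∧ SZ d + 1 ≤ b + 2 * a ∧ 2 * a - b ≤ SZ d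

/-- The reduction test is decidable. [folklore] -/
instance instDecidableRedTestZ (d a b : ℤ) : Decidable (RedTestZ d a b) := by unfold RedTestZ; infer_instance

/-- One reduction round with floats (`UnitResidueSteps.rstepF`). [folklore] -/
def rstepBody : Prog :=
  .ifp notRedE (mulFacBlk ;; .set 9 (.ite (.lt SE (.reg 4)) (.sub (.cst 0) (.reg 9)) (.reg 9)) ;; pstepBlk ;; normBlk)

/-- The sign update of a reduction round. [folklore] -/
def MS.sgnM (S : MS) : MS := { S with sgn := if SZ S.d < S.b then 0 - S.sgn else S.sgn }

/-- Machine function of `rstepBody`: one reduction round with floats. [folklore] -/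
def MS.rstepM (N : ℕ) (S : MS) : MS :=
  if RedTestZ S.d S.a S.b then S else (((S.mulFacM N).sgnM).pstepM).normM

/-- The body of one level: `i += 1; square (three Euclid loops, sqPost); normalise; reduce; walk`. [folklore] -/
def levelsCore : Prog :=
  .set 12 (.add (.reg 12) (.cst 1)) ;;
    loadBlk (.reg 3) (.reg 4) ;; .loop (invBlk (.reg 3)) ;; sqMid1 ;; .loop (invBlk a1E) ;; sqMid2 ;;
    .loop (invBlk (.reg 16)) ;; sqPost ;; normBlk ;; .loop rstepBody ;; .loop gstepBody

/-- One level: `if i < l - k₀ then levelsCore`. [folklore] -/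
def levelsBody : Prog := .ifp (.lt (.reg 12) (.sub lE (.reg 15))) levelsCore

/-- Loading the Euclid state `(a, b, 0, 1 mod a)`. [folklore] -/
def MS.loadA (S : MS) : MS := { S with u := S.a, v := S.b, w := 0, t := 1 % S.a }
/-- `g := u`; loading `(a₁, b₁, 0, 1 mod a₁)`. [folklore] -/
def MS.mid1 (S : MS) : MS := { S with g := S.u, u := S.a / S.u, v := S.b / S.u, w := 0, t := 1 % (S.a / S.u) }
/-- `ν := w`; loading `(g, c, 0, 1 mod g)`. [folklore] -/
def MS.mid2 (S : MS) : MS := { S with nu := S.w, u := S.g, v := cZ S.d S.a S.b, w := 0, t := 1 % S.g }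

/-- The final walk to the unit: `if a ≠ 1 then bstep`. [folklore] -/
def finBody : Prog := .ifp (.sub (.reg 3) (.cst 1)) bstepBlk

/-- Machine function of `finBody`: one round of the final walk. [folklore] -/
def MS.finM (S : MS) : MS := if S.a = 1 then S else S.bstepM

/-- The output `(ε mod m)`: `ox := sgn (2p₁ + σ p₂) mod m`, `oy := sgn (δ p₂) mod m`. [folklore] -/
def outBlk : Prog :=
  .set 23 (Ex.emod (.mul (.reg 9) (.add (.mul (.cst 2) (.reg 5)) (.mul sigE (.reg 6)))) (.reg 2)) ;;
  .set 24 (Ex.emod (.mul (.reg 9) (.mul dKE (.reg 6))) (.reg 2))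

/-- Machine function of `outBlk`: the output registers `(ε mod m)`. [folklore] -/
def MS.outM (S : MS) : MS :=
  { S with ox := S.sgn * (2 * S.p1 + sigZ S.d * S.p2) % S.m, oy := S.sgn * (dKZ S.d * S.p2) % S.m }

/-- The large-regulator branch: `k₀ := kz; i := 0; walk (phase A); levels`. [folklore] -/
def largeBlk : Prog := .set 15 (.cst 0) ;; .loop kzBody ;; .set 12 (.cst 0) ;; .loop gstepBody ;; .loop levelsBody

/-- **The whole machine.** [cite: JacobsonWilliams2008, Ch. 12, Alg. 12.6 (CR)] -/
def prog : Prog :=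
  .set 12 (.cst 0) ;; .set 13 (.cst 0) ;; .loop ln2Body ;; initBlk ;;
  .ifp (.le (.reg 14) (.mul (.cst 16) nE)) bstepBlk ;;
  .ifp (.lt (.mul (.cst 16) nE) (.reg 14)) largeBlk ;;
  .loop finBody ;; outBlk

/-! ### Symbolic execution of the straight-line blocks -/

section Blocks

variable (N : ℕ) (S : MS)

/-- Symbolic execution / simulation lemma for `mulFacBlk`. [folklore] -/
theorem run_mulFacBlk : mulFacBlk.run N S.lay = (S.mulFacM N).lay := by
  simp [mulFacBlk, MS.mulFacM, MS.lay, MS.fac, MS.mf, mulFz]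

/-- Symbolic execution / simulation lemma for `bstepBlk`. [folklore] -/
theorem run_bstepBlk : bstepBlk.run N S.lay = S.bstepM.lay := by
  simp [bstepBlk, MS.bstepM, MS.lay]

/-- Symbolic execution / simulation lemma for `ln2Body`. [folklore] -/
theorem run_ln2Body : ln2Body.run N S.lay = (S.ln2M N).lay := by
  unfold ln2Body MS.ln2M
  rw [run_ifp]
  by_cases h : S.i < KZ S.d S.r S.m
  · rw [if_pos h]; simp [MS.lay, h]
  · rw [if_neg h]; simp [MS.lay, h]

/-- Symbolic execution / simulation lemma for `initBlk`. [folklore] -/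
theorem run_initBlk : initBlk.run N S.lay = (S.initM N).lay := by
  simp [initBlk, MS.initM, MS.lay, b0E, b0Z]

/-- Symbolic execution / simulation lemma for `kzBody`. [folklore] -/
theorem run_kzBody : kzBody.run N S.lay = (S.kzM N).lay := by
  simp [kzBody, MS.kzM, MS.lay]

/-- Closed form of the value of the expression `gstepGuard` on a register file. [folklore] -/
theorem eval_gstepGuard : (Ex.lt (.add (.reg 11) PE) tgtE).eval N S.lay =
    if S.E + PZ S.d S.r S.m < prefZ N S.d S.r S.m S.rr (S.k0 + S.i) - c0Z S.d S.r S.m then 1 else 0 := by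
  simp [MS.lay]

/-- Symbolic execution / simulation lemma for `gstepBody`. [folklore] -/
theorem run_gstepBody : gstepBody.run N S.lay = (S.gstepM N).lay := by
  unfold gstepBody MS.gstepM
  rw [run_ifp, eval_gstepGuard]
  by_cases h : S.E + PZ S.d S.r S.m < prefZ N S.d S.r S.m S.rr (S.k0 + S.i) - c0Z S.d S.r S.m
  · rw [if_pos h, if_neg one_ne_zero, if_pos h, run_seq, run_mulFacBlk, run_bstepBlk]
  · rw [if_neg h, if_pos rfl, if_neg h]

/-- Symbolic execution / simulation lemma for `invBlkA`. [folklore] -/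
theorem run_invBlkA : (invBlk (.reg 3)).run N S.lay = (S.invM S.a).lay := by
  unfold invBlk MS.invM; rw [run_seq, run_ifp]; by_cases h : S.v = 0 <;> simp [MS.lay, h]

/-- Symbolic execution / simulation lemma for `invBlk1`. [folklore] -/
theorem run_invBlk1 : (invBlk a1E).run N S.lay = (S.invM (S.a / S.g)).lay := by
  unfold invBlk MS.invM; rw [run_seq, run_ifp]; by_cases h : S.v = 0 <;> simp [MS.lay, h, a1E]

/-- Symbolic execution / simulation lemma for `invBlk2`. [folklore] -/
theorem run_invBlk2 : (invBlk (.reg 16)).run N S.lay = (S.invM S.g).lay := by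
  unfold invBlk MS.invM; rw [run_seq, run_ifp]; by_cases h : S.v = 0 <;> simp [MS.lay, h]

/-- Symbolic execution / simulation lemma for `loadBlkA`. [folklore] -/
theorem run_loadBlkA : (loadBlk (.reg 3) (.reg 4)).run N S.lay = S.loadA.lay := by
  simp [loadBlk, MS.loadA, MS.lay]

/-- Symbolic execution / simulation lemma for `sqMid1`. [folklore] -/
theorem run_sqMid1 : sqMid1.run N S.lay = S.mid1.lay := by
  simp [sqMid1, loadBlk, MS.mid1, MS.lay, a1E, b1E]

/-- Symbolic execution / simulation lemma for `sqMid2`. [folklore] -/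
theorem run_sqMid2 : sqMid2.run N S.lay = S.mid2.lay := by
  simp [sqMid2, loadBlk, MS.mid2, MS.lay]

/-- Symbolic execution / simulation lemma for `sqPost`. [folklore] -/
theorem run_sqPost : sqPost.run N S.lay = (S.sqPostM N).lay := by
  simp [sqPost, MS.sqPostM, MS.lay, a1E, b1E, muE, kaE, om1, om2, omZ, mulFz]

/-- Symbolic execution / simulation lemma for `normBlk`. [folklore] -/
theorem run_normBlk : normBlk.run N S.lay = S.normM.lay := by
  simp [normBlk, MS.normM, MS.lay, bnE, bnZ]

/-- Symbolic execution / simulation lemma for `pstepBlk`. [folklore] -/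
theorem run_pstepBlk : pstepBlk.run N S.lay = S.pstepM.lay := by
  simp [pstepBlk, MS.pstepM, MS.lay]

/-- Symbolic execution / simulation lemma for `sgn`. [folklore] -/
theorem run_sgn : (Prog.set 9 (.ite (.lt SE (.reg 4)) (.sub (.cst 0) (.reg 9)) (.reg 9))).run N S.lay = S.sgnM.lay := by
  simp [MS.sgnM, MS.lay]

/-- Closed form of the value of the expression `notRedE` on a register file. [folklore] -/
theorem eval_notRedE : notRedE.eval N S.lay = 0 ↔ RedTestZ S.d S.a S.b := by
  simp only [notRedE, eval_add, eval_lt, eval_SE, eval_reg, eval_mul, eval_cst, eval_sub, MS.lay,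
    List.getD_cons_succ, List.getD_cons_zero, RedTestZ]
  split_ifs <;> constructor <;> intro h <;> omega

/-- Symbolic execution / simulation lemma for `rstepBody`. [folklore] -/
theorem run_rstepBody : rstepBody.run N S.lay = (S.rstepM N).lay := by
  unfold rstepBody MS.rstepM
  rw [run_ifp]
  by_cases h : RedTestZ S.d S.a S.b
  · rw [if_pos ((eval_notRedE N S).mpr h), if_pos h]
  · rw [if_neg (fun h' => h ((eval_notRedE N S).mp h')), if_neg h, run_seq, run_mulFacBlk, run_seq, run_sgn,
      run_seq, run_pstepBlk, run_normBlk]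

/-- Symbolic execution / simulation lemma for `finBody`. [folklore] -/
theorem run_finBody : finBody.run N S.lay = S.finM.lay := by
  unfold finBody MS.finM
  rw [run_ifp]
  have : (Ex.sub (.reg 3) (.cst 1)).eval N S.lay = S.a - 1 := by simp [MS.lay]
  rw [this]
  by_cases h : S.a = 1
  · rw [if_pos (by omega), if_pos h]
  · rw [if_neg (by omega), if_neg h, run_bstepBlk]

/-- Symbolic execution / simulation lemma for `outBlk`. [folklore] -/
theorem run_outBlk : outBlk.run N S.lay = S.outM.lay := by
  simp [outBlk, MS.outM, MS.lay]

/-- Closed form of the value of the expression `smallGuard` on a register file. [folklore] -/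
theorem eval_smallGuard : (Ex.le (.reg 14) (.mul (.cst 16) nE)).eval N S.lay =
    if S.rr ≤ 16 * nZ S.d S.r S.m then 1 else 0 := by
  simp [MS.lay]

/-- Closed form of the value of the expression `largeGuard` on a register file. [folklore] -/
theorem eval_largeGuard : (Ex.lt (.mul (.cst 16) nE) (.reg 14)).eval N S.lay =
    if 16 * nZ S.d S.r S.m < S.rr then 1 else 0 := by
  simp [MS.lay]

/-- Closed form of the value of the expression `levelsGuard` on a register file. [folklore] -/
theorem eval_levelsGuard : (Ex.lt (.reg 12) (.sub lE (.reg 15))).eval N S.lay =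
    if S.i < lZ S.d S.r S.m S.rr - S.k0 then 1 else 0 := by
  simp [MS.lay]

/-- Symbolic execution / simulation lemma for `incI`. [folklore] -/
theorem run_incI : (Prog.set 12 (.add (.reg 12) (.cst 1))).run N S.lay = ({ S with i := S.i + 1 } : MS).lay := by
  simp [MS.lay]

/-- Symbolic execution / simulation lemma for `setI0`. [folklore] -/
theorem run_setI0 : (Prog.set 12 (.cst 0)).run N S.lay = ({ S with i := 0 } : MS).lay := by simp [MS.lay]
/-- Symbolic execution / simulation lemma for `setAcc0`. [folklore] -/
theorem run_setAcc0 : (Prog.set 13 (.cst 0)).run N S.lay = ({ S with acc := 0 } : MS).lay := by simp [MS.lay]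
/-- Symbolic execution / simulation lemma for `setK0`. [folklore] -/
theorem run_setK0 : (Prog.set 15 (.cst 0)).run N S.lay = ({ S with k0 := 0 } : MS).lay := by simp [MS.lay]

/-- The initial register file: the inputs and zeros. [folklore] -/
def MS.init (d r m : ℕ) : MS := ⟨d, r, m, 0, 0, 0, 0, 0, 0, 0, 0, 0, 0, 0, 0, 0, 0, 0, 0, 0, 0, 0, 0, 0, 0⟩

/-! ### Clamped loops simulate their body function -/

/-- **Loop simulation**: a predicate preserved by the body function, under which the body program
computes the body function and every register stays below `2ᴺ`, makes the clamped loop compute the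
`N`-th iterate of the body function. [cite: AroraBarak2009, §1.3] -/
theorem run_loop_sim {N : ℕ} {body : Prog} {F : MS → MS} {Q : MS → Prop}
    (hrun : ∀ S, Q S → body.run N S.lay = (F S).lay) (hQ : ∀ S, Q S → Q (F S))
    (hB : ∀ S, Q S → ∀ z ∈ (F S).lay, z.natAbs < 2 ^ N) (S : MS) (hS : Q S) :
    (Prog.loop body).run N S.lay = (F^[N] S).lay ∧ Q (F^[N] S) := by
  rw [run_loop]
  suffices h : ∀ k, (fun l => clampAll N (body.run N l))^[k] S.lay = (F^[k] S).lay ∧ Q (F^[k] S) from h N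
  intro k
  induction k with
  | zero => exact ⟨rfl, hS⟩
  | succ k ih =>
    rw [Function.iterate_succ_apply', Function.iterate_succ_apply', ih.1, hrun _ ih.2,
      clampAll_of_forall (hB _ ih.2)]
    exact ⟨rfl, hQ _ ih.2⟩

end Blocks

end Literature.Computability.Cryptography.UnitResidue
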